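import Summits.ValiantsHypothesis.ValiantsHypothesis.Theorems.BarrierLeverChowBenchmarkPairsBlockPeelCertLU

/-!
# Route BarrierLever — item 22038 `ChowBenchmarkPairs`, line `moore-peel`: the BLOCK PEEL — the data-free LU certificate kit
# WITH ROW PIVOTING (`P · A = L · U`)

Helper file (`--supports stmt-ValiantsHypothesis-22038`; cell valiant-natproofs, rung V4, 𝒟-side benchmark of record,
line `moore_peel`, planner SUCCESSOR MANDATE M2 (HOME/STATUS.md l.1824); seat val-np-p4 gen 30).  Closes NO item; no
certificate is checked here.  Companion of `…BlockPeelCertLU` (no pivoting), needed because some tabulated blocks have a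
STRUCTURALLY singular leading principal minor (kit j330466: `J^{!}(363,2)` in window order at every point: zero pivot at
step 240 — a leading minor of the good single `G_363` in code order), so that Doolittle without pivoting cannot start.

* `lupPacked a n p : Array ℕ × Array ℕ` — UNVERIFIED in-place LU with row pivoting on the flat table: the packed `L\U`
  table and the row permutation `perm` (`(P A)[i] = A[perm[i]]`); `lupPermInv` its (unverified) inverse table;
* `lupPermCheck perm pinv n : Bool` — `perm`/`pinv` are mutually inverse maps of `[0,n)`; KERNEL: `lupPerm` turns a
  passed check into `σ : Equiv.Perm (Fin n)`;
* `luCheckP a lu perm n p : Bool` — diagonal of `U` nonzero mod `p` and `(L * U)[i,j] ≡ A[perm[i], j]`; KERNEL: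
  `luMatL_mul_luMatU_eq_submatrix` (`⇒ L * U = A.submatrix σ id`), `det_flatMat_ne_zero_of_luCheckP` (`Matrix.det_permute`),
  **`det_ne_zero_of_luCheckP`**, **`det_blockMatrix_X_ne_zero_of_luCheckP`** (symbolic block determinant `≠ 0`).
Certificate file: `def a := flatTable n (reindex e e (J^κ(i,t)(pt)))`, `def c := lupPacked a n p`,
`theorem chk : luCheckP a c.1 c.2 n p && lupPermCheck c.2 (lupPermInv c.2 n) n = true := by native_decide`, then
`det_blockMatrix_X_ne_zero_of_luCheckP`.

WHAT THIS IS NOT: nothing is certified in this file; node #1 `stub_segmentMeanValue` (∀ h) untouched; nothing on crux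
stmt-ValiantsHypothesis-14610 or on `VP` versus `VNP`.
-/

set_option linter.dupNamespace false

namespace Summit.ValiantsHypothesis.ValiantsHypothesis.Theorems.BarrierLever.MoorePeel

open Finset

/-! ## 1. The (unverified) pivoting LU routine -/

/-- **Candidate LU decomposition with row pivoting** (in place, flat row-major table): returns the packed `L\U` table of
`P · A` and the permutation table `perm` with `(P · A)[i] = A[perm[i]]`.  Unverified. -/
def lupPacked (a0 : Array ℕ) (n p : ℕ) : Array ℕ × Array ℕ := Id.run do
  let mut a := a0
  let mut perm : Array ℕ := Array.range n
  for k in [0:n] do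
    -- first row `r ≥ k` with a nonzero pivot candidate
    let mut r := k
    let mut found := false
    for r' in [k:n] do
      if !found && a.getD (n * r' + k) 0 % p != 0 then
        r := r'
        found := true
    if r != k then
      for j in [0:n] do
        let x := a.getD (n * k + j) 0
        let y := a.getD (n * r + j) 0
        a := (a.set! (n * k + j) y).set! (n * r + j) x
      let pk := perm.getD k 0
      let pr := perm.getD r 0
      perm := (perm.set! k pr).set! r pk
    let inv := powModNat (a.getD (n * k + k) 0) (p - 2) p
    for i in [k+1:n] do
      let f := (a.getD (n * i + k) 0 * inv) % p
      a := a.set! (n * i + k) f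
      if f != 0 then
        let nf := p - f
        for j in [k+1:n] do
          a := a.set! (n * i + j) ((a.getD (n * i + j) 0 + nf * a.getD (n * k + j) 0) % p)
  return (a, perm)

/-- The inverse table of a permutation table (unverified; validated by `lupPermCheck`). -/
def lupPermInv (perm : Array ℕ) (n : ℕ) : Array ℕ := Id.run do
  let mut q : Array ℕ := Array.replicate n 0
  for i in [0:n] do
    q := q.set! (perm.getD i 0) i
  return q

/-! ## 2. The checkers -/

/-- `perm` and `pinv` are mutually inverse self-maps of `[0, n)`. -/
def lupPermCheck (perm pinv : Array ℕ) (n : ℕ) : Bool :=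
  (List.range n).all fun i =>
    perm.getD i 0 < n && pinv.getD i 0 < n && pinv.getD (perm.getD i 0) 0 == i && perm.getD (pinv.getD i 0) 0 == i

/-- The LU checker against the ROW-PERMUTED table: diagonal of `U` nonzero mod `p` and `(L * U)[i,j] ≡ A[perm[i], j]`. -/
def luCheckP (a lu perm : Array ℕ) (n p : ℕ) : Bool :=
  (List.range n).all fun i =>
    (lu.getD (n * i + i) 0 % p != 0) &&
    (List.range n).all fun j => luDot lu n i j (min i j + 1) 0 % p == a.getD (n * perm.getD i 0 + j) 0 % p

/-! ## 3. Kernel facts -/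

/-- A passed `lupPermCheck` defines a permutation of `Fin n`. -/
def lupPerm (perm pinv : Array ℕ) (n : ℕ) (h : lupPermCheck perm pinv n = true) : Equiv.Perm (Fin n) where
  toFun i := ⟨perm.getD i.val 0, by
    have := List.all_eq_true.mp h i.val (List.mem_range.mpr i.2)
    simp only [Bool.and_eq_true, decide_eq_true_eq, beq_iff_eq] at this
    exact this.1.1.1⟩
  invFun i := ⟨pinv.getD i.val 0, by
    have := List.all_eq_true.mp h i.val (List.mem_range.mpr i.2)
    simp only [Bool.and_eq_true, decide_eq_true_eq, beq_iff_eq] at this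
    exact this.1.1.2⟩
  left_inv i := by
    have := List.all_eq_true.mp h i.val (List.mem_range.mpr i.2)
    simp only [Bool.and_eq_true, decide_eq_true_eq, beq_iff_eq] at this
    exact Fin.ext this.1.2
  right_inv i := by
    have := List.all_eq_true.mp h i.val (List.mem_range.mpr i.2)
    simp only [Bool.and_eq_true, decide_eq_true_eq, beq_iff_eq] at this
    exact Fin.ext this.2

/-- The permutation reads the table. -/
theorem lupPerm_apply (perm pinv : Array ℕ) (n : ℕ) (h : lupPermCheck perm pinv n = true) (i : Fin n) :
    ((lupPerm perm pinv n h) i).val = perm.getD i.val 0 := rfl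

section Matrices

variable (p : ℕ)

/-- **A passed pivoted check means `L * U = P * A`**: `luMatL * luMatU = (flatMat a).submatrix σ id`. -/
theorem luMatL_mul_luMatU_eq_submatrix (a lu perm pinv : Array ℕ) (n : ℕ) (h : luCheckP a lu perm n p = true)
    (hperm : lupPermCheck perm pinv n = true) :
    luMatL p lu n * luMatU p lu n = (flatMat p a n).submatrix (lupPerm perm pinv n hperm) id := by
  ext i j
  have hrow := List.all_eq_true.mp h i.val (List.mem_range.mpr i.2)
  rw [Bool.and_eq_true] at hrow
  have hij := List.all_eq_true.mp hrow.2 j.val (List.mem_range.mpr j.2)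
  rw [beq_iff_eq, luDot_eq_sum, zero_add, ← sum_range_luL_mul_luU lu n i.val j.val i.2] at hij
  rw [Matrix.mul_apply, Matrix.submatrix_apply, flatMat, id, lupPerm_apply]
  simp only [luMatL, luMatU]
  rw [← (ZMod.natCast_eq_natCast_iff' _ _ p).mpr hij, Nat.cast_sum]
  simp_rw [Nat.cast_mul]
  exact Fin.sum_univ_eq_sum_range (fun k => (luL lu n i.val k : ZMod p) * (luU lu n k j.val : ZMod p)) n

/-- With `p` prime, a passed pivoted check makes `det U ≠ 0`. -/
theorem det_luMatU_ne_zero_of_luCheckP [Fact p.Prime] (a lu perm : Array ℕ) (n : ℕ) (h : luCheckP a lu perm n p = true) :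
    (luMatU p lu n).det ≠ 0 := by
  rw [det_luMatU]
  refine Finset.prod_ne_zero_iff.mpr fun k _ hk => ?_
  have hrow := List.all_eq_true.mp h k.val (List.mem_range.mpr k.2)
  rw [Bool.and_eq_true] at hrow
  have hdiag := hrow.1
  rw [bne_iff_ne, ne_eq] at hdiag
  rw [ZMod.natCast_eq_zero_iff] at hk
  exact hdiag (Nat.mod_eq_zero_of_dvd hk)

/-- **A passed pivoted check certifies `det A ≠ 0`** (`p` prime; `det (P A) = sign · det A`). -/
theorem det_flatMat_ne_zero_of_luCheckP [Fact p.Prime] (a lu perm pinv : Array ℕ) (n : ℕ)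
    (h : luCheckP a lu perm n p = true) (hperm : lupPermCheck perm pinv n = true) : (flatMat p a n).det ≠ 0 := by
  intro h0
  have e := Matrix.det_permute (lupPerm perm pinv n hperm) (flatMat p a n)
  rw [h0, mul_zero, ← luMatL_mul_luMatU_eq_submatrix p a lu perm pinv n h hperm, Matrix.det_mul, det_luMatL,
    one_mul] at e
  exact det_luMatU_ne_zero_of_luCheckP p a lu perm n h e

end Matrices

/-! ## 4. From a checked pivoted certificate to the symbolic block determinant -/

/-- **`det A ≠ 0` from the pivoted LU check of its flat table** (`p` prime). -/
theorem det_ne_zero_of_luCheckP {p : ℕ} [Fact p.Prime] (n : ℕ) (A : Matrix (Fin n) (Fin n) (ZMod p))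
    (lu perm pinv : Array ℕ) (h : luCheckP (flatTable n A) lu perm n p = true)
    (hperm : lupPermCheck perm pinv n = true) : A.det ≠ 0 := by
  have := det_flatMat_ne_zero_of_luCheckP p (flatTable n A) lu perm pinv n h hperm
  rwa [flatMat_flatTable] at this

/-- **From a checked pivoted LU certificate of the tabulated block matrix to the symbolic block determinant**:
`luCheckP (flatTable n (reindex e e (J^κ(i,t)(pt)))) lu perm n p = true`, `lupPermCheck perm pinv n = true`
`⇒ det J^κ(i,t)(Λ) ≠ 0` in `ℤ[Λ]`. -/
theorem det_blockMatrix_X_ne_zero_of_luCheckP (κ : ℕ → ℕ) (i t n p : ℕ) [Fact p.Prime] (pt : Fin t → ZMod p)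
    (e : BlockIdx i t ≃ Fin n) (lu perm pinv : Array ℕ)
    (h : luCheckP (flatTable n (Matrix.reindex e e (blockMatrix κ i t pt))) lu perm n p = true)
    (hperm : lupPermCheck perm pinv n = true) :
    (blockMatrix κ i t (fun s : Fin t => (MvPolynomial.X s : MvPolynomial (Fin t) ℤ))).det ≠ 0 := by
  refine det_blockMatrix_X_ne_zero_of_point κ i t pt ?_
  have := det_ne_zero_of_luCheckP n _ lu perm pinv h hperm
  rwa [Matrix.det_reindex_self] at this

end Summit.ValiantsHypothesis.ValiantsHypothesis.Theorems.BarrierLever.MoorePeel
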